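import Summits.Ventures.HSemireg.WedgeHankelRecurrenceSynthesisInfinity

/-!
# Venture HSemireg — THE POLAR PART AT INFINITY: adding to a class `u` of middle rank `d` (minimal recurrence `m` of full degree `d`) a TAIL `τ` supported on the top `e` coefficients
# `q_{N+1−e}, …, q_N` with `τ_{N+1−e} ≠ 0` gives **`R(u + τ) = d + e` with the SAME minimal recurrence `m`** (`2(d + e) ≤ N + 1`): the degree drop `e` of the minimal recurrence below
# its window is exactly the order of the polar part at infinity; low-degree recurrences do not see tails (`deg p + e ≤ k ⇒ (p ∈ Rec_k(u + τ) ↔ p ∈ Rec_k(u))`), and every recurrence of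
# `u + τ` inside the window has its top `e` coefficients zero

HONEST FRAMING. Part of the Lean index of the computation cell `pub-hsemireg` (seat p10 gen 27, Sunday typer «UNIFORM-IN-n»).
LINEAR ALGEBRA OF HANKEL (catalecticant) MATRICES and of polynomials over a field ONLY: no variety, no cohomology theory, no sheaf, no Ext group and no semiregularity map is constructed
here; nothing here says that HC / HC_CM / HC_AV holds; no Literature fact is declared or used.  Custodian versions as in `WedgeHankelSiegelIdeal` (1/3); the dictionary (a tail supported on
`(N − e, N]` = a polar part `Σ_{t<e} c_t y^{N−t} x^t`-type class at the point `∞` of the rational normal curve, of order `e` when `c_{e−1} = τ_{N+1−e} ≠ 0`; `R(q) = rank H_{⌊N/2⌋}(q)`) is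
QUOTED, never asserted.

WHAT IS IN THE TREE.  N29 (`WedgeHankelRecurrenceSynthesisInfinity`, № 237): `mem_recSpace_succ_succ_iff` (one degree of slack frees the top coefficient); N23 (№ 176): `recSpace_congr`;
N18 (№ 173): `recSpace`, `mem_recSpace_iff`, `hkFun_eq_sum_range`, `hkFun_add_seq`, `recSpace_mono`, `mul_mem_recSpace_add`, `dvd_of_mem_recSpace`, `finrank_recSpace_add_rank`,
`finrank_recSpace_self`, `recSpace_eq_map_mulRight`, `recSpace_eq_degreeLT_of_lt`, `natDegree_le_of_mem_recSpace`; N15 `rank_hankel1_eq_min`; N26 (№ 179) proved the instance `u = charSeq m`,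
`τ = δ_{N+1−e}` (`rank_hankel1_half_charSeq_add_spike`), which this file generalises to every class and every tail.
THIS FILE (namespace `Summit.Ventures.HSemireg.Wedge.HankelOuter` continued; PLAIN over the tree; 0 definitions):
* §513 **`mem_recSpace_add_add_iff`** (`deg p ≤ k ⇒ (p ∈ Rec^{N+e}_{k+e}(q) ↔ p ∈ Rec^{N}_{k}(q))`), **`mem_recSpace_add_tail_iff`** (`τ = 0` on `[0, N − e]`, `deg p + e ≤ k ⇒ (p ∈ Rec_k(u + τ) ↔
  p ∈ Rec_k(u))`: recurrences with `e` spare degrees do not see a tail of order `≤ e`), `mem_recSpace_add_tail` (`m ∈ Rec_d(u) ⇒ m ∈ Rec_{d+e}(u + τ)`).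
* §514 for `R(u) = d`, `0 ≠ m ∈ Rec_d(u)`, `deg m = d`, a tail `τ` of exact order `e ≥ 1` (`τ = 0` on `[0, N − e]`, `τ_{N+1−e} ≠ 0`) and `2(d + e) ≤ N + 1`: **`recSpace_add_tail_eq_bot`**
  (`Rec_{d+e−1}(u + τ) = 0`: far from the top the tail is invisible so `m ∣ p`, then the tail equations kill the coefficients of `p` from the top down), **`rank_hankel1_half_add_tail`**
  (`R(u + τ) = d + e`: THE ORDER AT INFINITY ADDS TO THE MIDDLE RANK), **`recSpace_add_tail_self_eq_span`** (`Rec_{d+e}(u + τ) = K · m`: the minimal recurrence is that of the affine part, of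
  degree `d < d + e`), `recSpace_add_tail_eq_map_mulRight` (`Rec_{d+e+d′}(u + τ) = m · K[X]_{≤ d′}`), **`natDegree_add_le_of_mem_recSpace_add_tail`** (`k + d + e ≤ N + 1`: every recurrence
  of `u + τ` of window `k + 1` has degree `≤ k − e` — its top `e` coefficients vanish).
READING: N18 allowed a minimal recurrence of degree `< R(q)`; N22/N26/N29 read the drop as a node at infinity in examples; this file proves the general law behind it: a polar part of
order `e` at `∞` raises the middle rank by exactly `e` and leaves the minimal recurrence unchanged, its presence being recorded only by the degree drop.  The converse decomposition
(every class = affine part + polar part) follows with the duality leaf (`dualSeq`).  Nothing Ext-side.  New names only.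
-/

open Module Polynomial
open scoped Matrix Polynomial

namespace Summit.Ventures.HSemireg.Wedge.HankelOuter

open Summit.Ventures.HSemireg.Wedge Summit.Ventures.HSemireg.Wedge.Hankel

variable (K : Type*) [Field K] {N : ℕ}

/-! ## §513. Recurrences with spare degrees do not see the top coefficients -/

/-- **`deg p ≤ k ⇒ (p ∈ Rec^{N+e}_{k+e}(q) ↔ p ∈ Rec^{N}_{k}(q))`**: `e` degrees of slack in the window free the top `e` coefficients `q_{N+1}, …, q_{N+e}` (N29 iterated). -/
theorem mem_recSpace_add_add_iff {k : ℕ} {q : ℕ → K} {p : K[X]} (hp : p ∈ Polynomial.degreeLT K (k + 1)) (e : ℕ) :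
    p ∈ recSpace K (N + e) q (k + e) ↔ p ∈ recSpace K N q k := by
  induction e with
  | zero => exact Iff.rfl
  | succ e ih =>
    rw [← add_assoc, ← add_assoc, mem_recSpace_succ_succ_iff K (Polynomial.degreeLT_mono (by omega) hp), ih]

/-- **A TAIL IS INVISIBLE TO LOW-DEGREE RECURRENCES: if `τ` vanishes on `[0, N − e]` and `deg p + e ≤ k`, then `p ∈ Rec_k(u + τ) ↔ p ∈ Rec_k(u)`** (the functionals `⟪p, ·⟫_s`,
`s + k ≤ N`, only read indices `≤ deg p + s ≤ N − e`). -/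
theorem mem_recSpace_add_tail_iff {e k : ℕ} {u τ : ℕ → K} (hτ : ∀ j, j + e ≤ N → τ j = 0) {p : K[X]} (hp : p.natDegree + e ≤ k) :
    p ∈ recSpace K N (u + τ) k ↔ p ∈ recSpace K N u k := by
  rcases Nat.lt_or_ge N k with hNk | hkN
  · rw [recSpace_eq_degreeLT_of_lt K hNk, recSpace_eq_degreeLT_of_lt K hNk]
  · obtain ⟨k', rfl⟩ := Nat.exists_eq_add_of_le' (show e ≤ k by omega)
    obtain ⟨N', rfl⟩ := Nat.exists_eq_add_of_le' (show e ≤ N by omega)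
    have hp' : p ∈ Polynomial.degreeLT K (k' + 1) := (mem_degreeLT_succ_iff K).mpr (by omega)
    rw [mem_recSpace_add_add_iff K hp', mem_recSpace_add_add_iff K hp',
      recSpace_congr K (N := N') (q := u + τ) (q' := u) (fun j hj => by rw [Pi.add_apply, hτ j (by omega), add_zero])]

/-- hence a recurrence `m ∈ Rec_d(u)` of degree `≤ d` survives a tail of order `≤ e` in the window `d + e + 1`: `m ∈ Rec_{d+e}(u + τ)`. -/
theorem mem_recSpace_add_tail {d e : ℕ} {u τ : ℕ → K} (hτ : ∀ j, j + e ≤ N → τ j = 0) {m : K[X]} (hm : m ∈ recSpace K N u d) :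
    m ∈ recSpace K N (u + τ) (d + e) :=
  (mem_recSpace_add_tail_iff K hτ (by have := natDegree_le_of_mem_recSpace K hm; omega)).mpr (recSpace_mono K u (Nat.le_add_right d e) hm)

/-! ## §514. A tail of exact order `e` raises the middle rank by `e` and keeps the minimal recurrence -/

section Tail

variable {d e : ℕ} {u τ : ℕ → K} {m : K[X]}
  (hu : (hankel1 K N (N / 2) u).rank = d) (hm : m ∈ recSpace K N u d) (hm0 : m ≠ 0) (hmd : m.natDegree = d)
  (hτ : ∀ j, j + e ≤ N → τ j = 0) (hτe : τ (N + 1 - e) ≠ 0) (he : 1 ≤ e) (h2 : d + e + (d + e) ≤ N + 1)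
include hu hm hm0 hmd hτ hτe he h2

/-- **NO RECURRENCE OF WINDOW `d + e` for `u + τ`: `Rec_{d+e−1}(u + τ) = 0`.**  A recurrence `p` of degree `≤ d + e − 1` is invisible to the tail in the longer window `d + 2e`, so it is a
recurrence of `u` there and `m ∣ p` (N18); then `⟪p, u⟫_s = 0` throughout the short window, so `⟪p, τ⟫_s = 0` there too, and these tail equations `p_j τ_{N+1−e} + (higher p's) = 0`
kill `p_j` for `j = d + e − 1, …, d` from the top down; a non-zero multiple of `m` cannot have degree `< d`. -/
theorem recSpace_add_tail_eq_bot : recSpace K N (u + τ) (d + e - 1) = ⊥ := by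
  rw [Submodule.eq_bot_iff]
  intro p hp
  have hdeg := natDegree_le_of_mem_recSpace K hp
  -- (1) `p ∈ Rec_{d+2e−1}(u)`, hence `m ∣ p`, hence `p = g · m ∈ Rec_{d+e−1}(u)`
  have h1 : p ∈ recSpace K N u (d + e - 1 + e) :=
    (mem_recSpace_add_tail_iff K hτ (by omega)).mp (recSpace_mono K (u + τ) (Nat.le_add_right _ e) hp)
  have hdvd : m ∣ p := dvd_of_mem_recSpace K hu (k := d + e - 1 + e) (by omega) hm hm0 h1
  have h2u : p ∈ recSpace K N u (d + e - 1) := by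
    obtain ⟨g, rfl⟩ := hdvd
    rcases eq_or_ne g 0 with hg | hg
    · rw [hg, mul_zero]; exact Submodule.zero_mem _
    · have hgdeg : g.natDegree ≤ e - 1 := by rw [Polynomial.natDegree_mul hm0 hg, hmd] at hdeg; omega
      rw [mul_comm, show d + e - 1 = d + (e - 1) by omega]
      exact mul_mem_recSpace_add K ((mem_degreeLT_succ_iff K).mpr hgdeg) hm
  -- (2) the tail equations: `⟪p, τ⟫_s = 0` for `s + (d + e − 1) ≤ N`
  have hτeq : ∀ s, s + (d + e - 1) ≤ N → hkFun K τ s p = 0 := fun s hs => by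
    have h := ((mem_recSpace_iff K).mp hp).2 s hs
    rwa [hkFun_add_seq, ((mem_recSpace_iff K).mp h2u).2 s hs, zero_add] at h
  -- (3) downward induction: all coefficients of index `≥ d + e − n` vanish, `n ≤ e`
  have key : ∀ n ≤ e, ∀ j, d + e - n ≤ j → p.coeff j = 0 := by
    intro n
    induction n with
    | zero => intro _ j hj; exact Polynomial.coeff_eq_zero_of_natDegree_lt (by omega)
    | succ n ih =>
      intro hn j hj
      rcases Nat.lt_or_ge j (d + e - n) with hlt | hge
      · -- `j = d + e − n − 1 ≥ d`; use the tail equation at `s = N + 1 − e − j`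
        have hj' : j = d + e - n - 1 := by omega
        have hs : N + 1 - e - j + (d + e - 1) ≤ N := by omega
        have h := hτeq (N + 1 - e - j) hs
        rw [hkFun_eq_sum_range K τ _ (n := d + e) (by omega), Finset.sum_eq_single j] at h
        · rw [show j + (N + 1 - e - j) = N + 1 - e by omega] at h
          exact (mul_eq_zero.mp h).resolve_right hτe
        · intro i hi hij
          rcases Nat.lt_or_gt_of_ne hij with hlt' | hgt'
          · rw [hτ (i + (N + 1 - e - j)) (by omega), mul_zero]
          · rw [ih (by omega) i (by omega), zero_mul]
        · intro hjn; exact absurd (Finset.mem_range.mpr (by omega)) hjn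
      · exact ih (by omega) j hge
  -- (4) so `deg p < d`, impossible for a non-zero multiple of `m`
  by_contra hne
  have hnd : d ≤ p.natDegree := hmd ▸ Polynomial.natDegree_le_of_dvd hdvd hne
  exact (Polynomial.leadingCoeff_ne_zero.mpr hne) (key e le_rfl p.natDegree (by omega))

/-- **THE ORDER AT INFINITY ADDS TO THE MIDDLE RANK: `R(u + τ) = d + e`.** -/
theorem rank_hankel1_half_add_tail : (hankel1 K N (N / 2) (u + τ)).rank = d + e := by
  set q := u + τ
  have hRle : (hankel1 K N (N / 2) q).rank ≤ N / 2 + 1 := Matrix.rank_le_height _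
  -- no recurrence in degree `d + e − 1`, the recurrence `m` in degree `d + e`; rank–nullity and the trapezoid law
  have hA0 := finrank_recSpace_add_rank K (N := N) (d + e - 1) q
  rw [recSpace_add_tail_eq_bot K hu hm hm0 hmd hτ hτe he h2, finrank_bot] at hA0
  have hA := rank_hankel1_eq_min K (show d + e - 1 ≤ N by omega) q
  have hB0 := finrank_recSpace_add_rank K (N := N) (d + e) q
  have hB1 : 1 ≤ finrank K (recSpace K N q (d + e)) := by
    haveI := finiteDimensional_recSpace K (N := N) q (d + e)
    have h := Submodule.finrank_mono ((Submodule.span_singleton_le_iff_mem m _).mpr (mem_recSpace_add_tail K (N := N) hτ hm))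
    rw [finrank_span_singleton hm0] at h
    exact h
  have hB := rank_hankel1_eq_min K (show d + e ≤ N by omega) q
  omega

/-- **… AND THE MINIMAL RECURRENCE IS THAT OF THE AFFINE PART: `Rec_{d+e}(u + τ) = K · m`** (of degree `d`, i.e. with its top `e` coefficients zero). -/
theorem recSpace_add_tail_self_eq_span : recSpace K N (u + τ) (d + e) = K ∙ m := by
  haveI := finiteDimensional_recSpace K (N := N) (u + τ) (d + e)
  symm
  refine Submodule.eq_of_le_of_finrank_eq ((Submodule.span_singleton_le_iff_mem _ _).mpr (mem_recSpace_add_tail K hτ hm)) ?_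
  rw [finrank_span_singleton hm0, finrank_recSpace_self K (rank_hankel1_half_add_tail K hu hm hm0 hmd hτ hτe he h2) h2]

/-- module form: `Rec_{d+e+d′}(u + τ) = m · K[X]_{≤ d′}` for `2(d + e) + d′ ≤ N + 1`. -/
theorem recSpace_add_tail_eq_map_mulRight {d' : ℕ} (hd' : d + e + d' + (d + e) ≤ N + 1) :
    recSpace K N (u + τ) (d + e + d') = (Polynomial.degreeLT K (d' + 1)).map (LinearMap.mulRight K m) :=
  recSpace_eq_map_mulRight K (rank_hankel1_half_add_tail K hu hm hm0 hmd hτ hτe he h2) hd' (mem_recSpace_add_tail K hτ hm) hm0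

/-- **EVERY RECURRENCE OF `u + τ` INSIDE THE WINDOW HAS ITS TOP `e` COEFFICIENTS ZERO: `p ∈ Rec_k(u + τ)`, `k + d + e ≤ N + 1 ⇒ deg p + e ≤ k`** (or `p = 0`). -/
theorem natDegree_add_le_of_mem_recSpace_add_tail {k : ℕ} (hk : k + d + e ≤ N + 1) {p : K[X]} (hp : p ∈ recSpace K N (u + τ) k) (hp0 : p ≠ 0) :
    p.natDegree + e ≤ k := by
  have hR := rank_hankel1_half_add_tail K hu hm hm0 hmd hτ hτe he h2
  rcases Nat.lt_or_ge k (d + e) with hlt | hle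
  · exfalso
    have h0 := recSpace_eq_bot_of_lt K hR hlt
    rw [h0, Submodule.mem_bot] at hp
    exact hp0 hp
  · obtain ⟨d', rfl⟩ := Nat.exists_eq_add_of_le hle
    rw [recSpace_add_tail_eq_map_mulRight K hu hm hm0 hmd hτ hτe he h2 (by omega)] at hp
    obtain ⟨g, hg, rfl⟩ := hp
    rw [LinearMap.mulRight_apply] at hp0 ⊢
    have hg0 : g ≠ 0 := left_ne_zero_of_mul hp0
    have := (mem_degreeLT_succ_iff K).mp hg
    rw [Polynomial.natDegree_mul hg0 hm0, hmd]
    omega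

end Tail

end Summit.Ventures.HSemireg.Wedge.HankelOuter
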